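import Literature.MathematicalPhysics.QuantumFieldTheory.Balaban1983to89.B9Eq346MixedLegAtPinsL2Closed
import Literature.MathematicalPhysics.QuantumFieldTheory.Balaban1983to89.Node00.Record11
import Literature.MathematicalPhysics.QuantumFieldTheory.Balaban1983to89.B9PinGeometryKLevelV1
import Literature.MathematicalPhysics.QuantumFieldTheory.Balaban1983to89.B9RWSumsDefinitePins
import Literature.MathematicalPhysics.QuantumFieldTheory.Balaban1983to89.B9RWSumsDefinitePinsPairM
import Literature.MathematicalPhysics.QuantumFieldTheory.Balaban1983to89.B7Prop2SpecialUnitary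

/-!
# BalabanUVNodes ∕ N06 ([B9], `Dag.B9_main`) — ROWS 18's MIXED `L²` LEG (`L2MixedLegs37`, the (3.46) line `|∇_{U,ν} M_h G′_□ M_h ∇*_{U,μ}|`) AT THE WALK-LETTER PINS
# OF def-Y's MEMBERS: the member-∀ knit of dag-n06-w7's `l2MixedLegs37_memberY_at` (named constants `MMix aMix BMix δMix`) into the certificate's binder shape

Track A of `YM-PLAN.md` (cell `pub-ymgap`, HUMAN RULING D-0062), node **N06** = [Balaban1985BackgroundPropagators] Thms 3.1–3.15; seat `pub-ymgap-dag-n06-d`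
(s2, «knit N06 at the ₁₁ record»), gen 11.  A HELPER for the stage-11 certificate editions ≥ 33.

WHAT.  Rows 18 of the certificate (Theorem 3.7 ∕ Corollary 3.8 for `G′(U)`) display, inside `h36H`, the mixed `L²` leg schema `L2MixedLegs37 (𝔬 x) (𝔡 x) 1 (H x) (SM x)
pM.BM p.δ₀ U` (n06-k's species: `∀ □ ν μ, BlockBd blk blk (∇_{U,ν} ∘ (M_{h_□} G′_□ M_{h_□}) ∘ ∇*_{U,μ}) (1_{S_□}(a)·B_M·e^{−δ₀d})`).  dag-n06-w7 PROVED it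
(`B9Eq346MixedLegAtPinsL2.l2MixedLegs37_memberY`, p617225; n06-w1's □-uniform Agmon estimates read through Parseval) for the cube-indexed walk letters `ι := cubes`,
`S_□ := SblkY x bI □`, at the pins `h_□ = hWalkY`, `G′_□ = gsqcoS … (parSymY) □ U`, `∇_{U,ν} ∕ ∇*_{U,μ}` = the certificate's `h𝔡d ∕ h𝔡s` texts, in a regime `M_M ≤ M_x`,
`c·M_x·α₀ ≤ a_M`, `U` in (3.35), with `∃`-constants NAMED in `B9Eq346MixedLegAtPinsL2Closed` (`MMix aMix BMix δMix`, `l2MixedLegs37_memberY_at`).  THIS FILE knits it into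
the certificate's binder shapes: ★ `l2MixedLegs37_mono` (weaken `B_M` up, the rate down); ★★ `l2MixedLegs37_of_pins` — for every member and every `U` in `h36H`'s OWN regime
prefix (`p.M₁ ≤ M_x`, `c35Y·M_x·α₀ ≤ p.a₁`, `Reg335 c35Y α₀ U`) the displayed conjunct AT THE DISPLAYED numerics `pM.BM ∕ p.δ₀`, given four numeric side conditions
`MMix ≤ p.M₁`, `p.a₁ ≤ aMix`, `BMix ≤ pM.BM`, `p.δ₀ ≤ δMix` and the pins; ★ `h36H_of_mixed` — the `h36H` family WITH the mixed leg from the family WITHOUT it + the derived leg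
(conjuncts abstract); ★ `hcntM_of_walkCnt` — the overlap count `hcntM` of `S_□ := SblkY` from this seat's `B9WalkLettersCoordsS.sum_indicator_SblkY_le` under a displayed
member floor `walkCntM₀Y ≤ M_x` and `walkCntY ≤ pM.NM`.
HONEST FRAMING.  Kernel bookkeeping (one application of dag-n06-w7's theorem per member and configuration, one kernel domination); COUNT-NEUTRAL; the analytic content is
dag-n06-w1's ∕ dag-n06-w7's landed theorems, consumed by name; nothing else of [B9] asserted; N06 NOT discharged.  One finite 𝕋⁴ programme at fixed `ε` — NOT continuum,
NOT OS, NOT the mass gap ∕ Clay.  0 `def`, 0 `sorry`.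
-/

noncomputable section

namespace Summit.QuantumFields.YangMills.BalabanUVNodes.N06MixedLegAtPinsPhys

open Literature.MathematicalPhysics.QuantumFieldTheory.Balaban1983to89
open Literature.MathematicalPhysics.QuantumFieldTheory.Balaban1983to89.Node00 (SiteY FBondY IBondY CfgY etaS parSymY Stage11Params)
open Literature.MathematicalPhysics.QuantumFieldTheory.Balaban1983to89.T4Continuum (T4Family)
open Literature.MathematicalPhysics.QuantumFieldTheory.Balaban1983to89.B6Ineq2142KLevelV1 (lvl β)
open Literature.MathematicalPhysics.QuantumFieldTheory.Balaban1983to89.B6GlobalChartV1 (blkV1)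
open Literature.MathematicalPhysics.QuantumFieldTheory.Balaban1983to89.B6Geom246MultiLevelTorus (geomT)
open Literature.MathematicalPhysics.QuantumFieldTheory.Balaban1983to89.B9Ineq349SiteComposite (cdSL cdsSL)
open Literature.MathematicalPhysics.QuantumFieldTheory.Balaban1983to89.B9CoReadingCoords (coordOpK)
open Literature.MathematicalPhysics.QuantumFieldTheory.Balaban1983to89.B9CoReadingCoordsS (XSK blkSK sIK)
open Literature.MathematicalPhysics.QuantumFieldTheory.Balaban1983to89.B9CoReadingCoordsTranspose (TrIdx trBasis)
open Literature.MathematicalPhysics.QuantumFieldTheory.Balaban1983to89.B9Thm34Ext (toB6)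
open Literature.MathematicalPhysics.QuantumFieldTheory.Balaban1983to89.B9SectDL2Decay (BlockBd)
open Literature.MathematicalPhysics.QuantumFieldTheory.Balaban1983to89.B9PinMembersKLevelV1 (MemberY geo9Y bg9Y)
open Literature.MathematicalPhysics.QuantumFieldTheory.Balaban1983to89.B9PinGeometryKLevelV1 (c35Y c35Y_pos)
open Literature.MathematicalPhysics.QuantumFieldTheory.Balaban1983to89.B9GeoNormsKLevelV1 (geo9K_dist_nonneg)
open Literature.MathematicalPhysics.QuantumFieldTheory.Balaban1983to89.B9Thm37Whole (Ops)
open Literature.MathematicalPhysics.QuantumFieldTheory.Balaban1983to89.B9RWSums346SecondDiffGp (DirOps37)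
open Literature.MathematicalPhysics.QuantumFieldTheory.Balaban1983to89.B9RWSums346MixedPair (L2MixedLegs37)
open Literature.MathematicalPhysics.QuantumFieldTheory.Balaban1983to89.B9RWSumsDefinitePins (PinPrims)
open Literature.MathematicalPhysics.QuantumFieldTheory.Balaban1983to89.B9RWSumsDefinitePinsPairM (MixedPrims)
open Literature.MathematicalPhysics.QuantumFieldTheory.Balaban1983to89.B6Cover236MultiLevelBlocks (cubes)
open Literature.MathematicalPhysics.QuantumFieldTheory.Balaban1983to89.B9WalkLettersCoordsS (SblkY hWalkY gsqcoS walkCntM₀Y walkCntY sum_indicator_SblkY_le)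
open Literature.MathematicalPhysics.QuantumFieldTheory.Balaban1983to89.B9Eq346MixedLegAtPinsL2Closed (MMix aMix BMix δMix BMix_pos l2MixedLegs37_memberY_at)
open Literature.MathematicalPhysics.QuantumFieldTheory.Balaban1983to89.B7Prop2SpecialUnitary (specialUnitaryUnits specialUnitaryUnits_le_unitaryUnits)
open scoped Matrix.Norms.L2Operator

/-! ## §1 Weakening the constants of the mixed leg -/

section Mono

variable {g : B9.Geometry} [Fintype g.Site] [DecidableEq g.Site] {B : B9.Backgrounds} {X Y ι P : Type} [Fintype X]

/-- ★ a larger constant and a smaller rate weaken `L2MixedLegs37` (kernel domination `1_S·B·e^{−δd} ≤ 1_S·B′·e^{−δ′d}` for `0 ≤ B ≤ B′`, `δ′ ≤ δ`, `d ≥ 0`).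
[cite: Balaban1985BackgroundPropagators, (3.46) p.398; Balaban1984PropagatorsII, (2.51) p.232, bookkeeping] -/
theorem l2MixedLegs37_mono (𝔬 : Ops g B X Y ι) (𝔡 : DirOps37 𝔬 P) {R : ℝ} {H : Prop} {SM : ι → Finset g.Site} {BM BM' δ δ' : ℝ} {U : B.Cfg}
    (hdist : ∀ a b : g.Site, 0 ≤ g.dist a b) (h : L2MixedLegs37 𝔬 𝔡 R H SM BM δ U) (hB0 : 0 ≤ BM) (hB : BM ≤ BM') (hδ : δ' ≤ δ) :
    L2MixedLegs37 𝔬 𝔡 R H SM BM' δ' U :=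
  ⟨fun i ν μ => (h.lm i ν μ).mono fun a b => by
    refine mul_le_mul_of_nonneg_left ?_ (by split_ifs <;> norm_num)
    exact mul_le_mul hB (Real.exp_le_exp.2 (neg_le_neg (mul_le_mul_of_nonneg_right hδ (hdist a b)))) (Real.exp_nonneg _) (hB0.trans hB)⟩

end Mono

/-! ## §2 At def-Y's members of record: the certificate's binder shape -/

variable {N : ℕ} {F : T4Family}

/-- ★★ **THE MIXED `L²` LEG OF `h36H` AT THE WALK-LETTER PINS** (module docstring): for `ι := cubes`, `S_□ := SblkY x (bI x) □`, pins `hblkS hhS hGsqF h𝔡d h𝔡s`, the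
numerics `MMix ≤ p.M₁`, `p.a₁ ≤ aMix`, `BMix ≤ pM.BM`, `p.δ₀ ≤ δMix` — in `h36H`'s regime prefix, `L2MixedLegs37 (𝔬 x) (𝔡 x) 1 (H x) (SblkY x (bI x)) pM.BM p.δ₀ U`.
[cite: Balaban1985BackgroundPropagators, Cor 3.6 p.408, Thm 3.1 (3.46) p.398, (3.87)–(3.90) pp.409–410, (3.35) p.396; Balaban1984PropagatorsII, (2.46) p.231, (2.51)–(2.54) pp.232–233] -/
theorem l2MixedLegs37_of_pins [NeZero N] (θ : Stage11Params F N) (Mstar : ℕ)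
    [∀ x : MemberY θ.d₆ θ.ℓ₆ θ.hd' θ.hL' θ.b₀ θ.b₁ Mstar, Fintype (geo9Y x).Site] [∀ x : MemberY θ.d₆ θ.ℓ₆ θ.hd' θ.hL' θ.b₀ θ.b₁ Mstar, DecidableEq (geo9Y x).Site]
    (H : MemberY θ.d₆ θ.ℓ₆ θ.hd' θ.hL' θ.b₀ θ.b₁ Mstar → Prop)
    (bI : ∀ x : MemberY θ.d₆ θ.ℓ₆ θ.hd' θ.hL' θ.b₀ θ.b₁ Mstar, FBondY x.toKIdx → IBondY x.toKIdx)
    (hlev : ∀ (x : MemberY θ.d₆ θ.ℓ₆ θ.hd' θ.hL' θ.b₀ θ.b₁ Mstar) (f : FBondY x.toKIdx), lvl x.hN x.D x.hk (bI x f) = (blkV1 x.hN x.D f).1.1)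
    (hβ1 : ∀ (x : MemberY θ.d₆ θ.ℓ₆ θ.hd' θ.hL' θ.b₀ θ.b₁ Mstar) (f : FBondY x.toKIdx), (geomT x.D).dist (β x.hN x.D x.hk (bI x f)) (blkV1 x.hN x.D f) ≤ 1)
    (𝔬 : ∀ x : MemberY θ.d₆ θ.ℓ₆ θ.hd' θ.hL' θ.b₀ θ.b₁ Mstar, Ops (geo9Y x) (bg9Y (Matrix (Fin N) (Fin N) ℂ) (specialUnitaryUnits (Fin N)) x) (XSK (TrIdx N) x.toKIdx) (XSK (TrIdx N) x.toKIdx) ↥(cubes x.toKIdx.D.toDomains))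
    (𝔡 : ∀ x : MemberY θ.d₆ θ.ℓ₆ θ.hd' θ.hL' θ.b₀ θ.b₁ Mstar, DirOps37 (𝔬 x) (Fin (θ.d₆ + 1)))
    (hblkS : ∀ x : MemberY θ.d₆ θ.ℓ₆ θ.hd' θ.hL' θ.b₀ θ.b₁ Mstar, (𝔬 x).blk = blkSK x.toKIdx (sIK x.toKIdx (bI x)))
    (hhS : ∀ (x : MemberY θ.d₆ θ.ℓ₆ θ.hd' θ.hL' θ.b₀ θ.b₁ Mstar) (c : ↥(cubes x.toKIdx.D.toDomains)), (𝔬 x).h c = hWalkY x c)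
    (hGsqF : ∀ (x : MemberY θ.d₆ θ.ℓ₆ θ.hd' θ.hL' θ.b₀ θ.b₁ Mstar) (U : (bg9Y (Matrix (Fin N) (Fin N) ℂ) (specialUnitaryUnits (Fin N)) x).Cfg) (c : ↥(cubes x.toKIdx.D.toDomains)),
      (𝔬 x).Gsq U c = gsqcoS x (trBasis N) (bg9Y (Matrix (Fin N) (Fin N) ℂ) (specialUnitaryUnits (Fin N)) x) (fun U => U) (parSymY x.toKIdx) c U)
    (h𝔡d : ∀ (x : MemberY θ.d₆ θ.ℓ₆ θ.hd' θ.hL' θ.b₀ θ.b₁ Mstar) (U : (bg9Y (Matrix (Fin N) (Fin N) ℂ) (specialUnitaryUnits (Fin N)) x).Cfg),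
      (𝔡 x).Dd U = fun μ => (etaS x.toKIdx)⁻¹ • coordOpK (trBasis N) (fun _ : Fin (θ.d₆ + 1) => (cdSL x.toKIdx U μ).restrictScalars ℝ))
    (h𝔡s : ∀ (x : MemberY θ.d₆ θ.ℓ₆ θ.hd' θ.hL' θ.b₀ θ.b₁ Mstar) (U : (bg9Y (Matrix (Fin N) (Fin N) ℂ) (specialUnitaryUnits (Fin N)) x).Cfg),
      (𝔡 x).Dsd U = fun μ => (etaS x.toKIdx)⁻¹ • coordOpK (trBasis N) (fun _ : Fin (θ.d₆ + 1) => (cdsSL x.toKIdx U μ).restrictScalars ℝ))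
    (p : PinPrims) (pM : MixedPrims)
    (hM1 : MMix θ.d₆ θ.ℓ₆ θ.hd' θ.hL' θ.b₀ θ.b₁ Mstar N c35Y c35Y_pos ≤ p.M₁) (ha1 : p.a₁ ≤ aMix θ.d₆ θ.ℓ₆ θ.hd' θ.hL' θ.b₀ θ.b₁ Mstar N c35Y c35Y_pos)
    (hBM : BMix θ.d₆ θ.ℓ₆ θ.hd' θ.hL' θ.b₀ θ.b₁ Mstar N c35Y c35Y_pos ≤ pM.BM) (hδM : p.δ₀ ≤ δMix θ.d₆ θ.ℓ₆ θ.hd' θ.hL' θ.b₀ θ.b₁ Mstar N c35Y c35Y_pos) :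
    ∀ x : MemberY θ.d₆ θ.ℓ₆ θ.hd' θ.hL' θ.b₀ θ.b₁ Mstar, p.M₁ ≤ (geo9Y x).M → ∀ α₀ : ℝ, 0 < α₀ → c35Y * (geo9Y x).M * α₀ ≤ p.a₁ →
      ∀ U : (bg9Y (Matrix (Fin N) (Fin N) ℂ) (specialUnitaryUnits (Fin N)) x).Cfg, (bg9Y (Matrix (Fin N) (Fin N) ℂ) (specialUnitaryUnits (Fin N)) x).Reg335 c35Y α₀ U →
        L2MixedLegs37 (𝔬 x) (𝔡 x) 1 (H x) (SblkY x (bI x)) pM.BM p.δ₀ U := fun x hM α₀ hα ha U hU =>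
  l2MixedLegs37_mono (𝔬 x) (𝔡 x) (fun a b => geo9K_dist_nonneg x.toKIdx a b)
    (l2MixedLegs37_memberY_at θ.d₆ θ.ℓ₆ θ.hd' θ.hL' θ.b₀ θ.b₁ Mstar N c35Y c35Y_pos specialUnitaryUnits_le_unitaryUnits x (hM1.trans hM) α₀ hα (ha.trans ha1) U hU
      (hlev x) (hβ1 x) 1 (H x) (𝔬 x) (𝔡 x) (hblkS x) (hhS x) (hGsqF x U) (fun ν => congrFun (h𝔡d x U) ν) (fun μ => congrFun (h𝔡s x U) μ))
    (BMix_pos θ.d₆ θ.ℓ₆ θ.hd' θ.hL' θ.b₀ θ.b₁ Mstar N c35Y c35Y_pos).le hBM hδM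

/-- ★ **`h36H` WITH the mixed leg FROM `h36H` WITHOUT it + the derived leg family** (conjuncts abstract; same regime prefix).
[cite: Balaban1985BackgroundPropagators, (3.46) p.398, bookkeeping] -/
theorem h36H_of_mixed {d ℓ : ℕ} {hd : 1 ≤ d + 1} {hL : Odd (ℓ + 1) ∧ 1 < ℓ + 1} {b₀ b₁ : ℝ} {Mstar : ℕ}
    {M₁ a₁ c : ℝ} {P₁ P₂ P₃ P₄ P₅ P₆ P₇ P₈ : ∀ x : MemberY d ℓ hd hL b₀ b₁ Mstar, (bg9Y (Matrix (Fin N) (Fin N) ℂ) (specialUnitaryUnits (Fin N)) x).Cfg → Prop}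
    (h36H : ∀ x : MemberY d ℓ hd hL b₀ b₁ Mstar, M₁ ≤ (geo9Y x).M → ∀ α₀ : ℝ, 0 < α₀ → c * (geo9Y x).M * α₀ ≤ a₁ →
      ∀ U : (bg9Y (Matrix (Fin N) (Fin N) ℂ) (specialUnitaryUnits (Fin N)) x).Cfg, (bg9Y (Matrix (Fin N) (Fin N) ℂ) (specialUnitaryUnits (Fin N)) x).Reg335 c α₀ U →
        P₁ x U ∧ P₂ x U ∧ (P₃ x U ∧ P₄ x U) ∧ (P₅ x U ∧ P₆ x U) ∧ P₈ x U)
    (hm : ∀ x : MemberY d ℓ hd hL b₀ b₁ Mstar, M₁ ≤ (geo9Y x).M → ∀ α₀ : ℝ, 0 < α₀ → c * (geo9Y x).M * α₀ ≤ a₁ →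
      ∀ U : (bg9Y (Matrix (Fin N) (Fin N) ℂ) (specialUnitaryUnits (Fin N)) x).Cfg, (bg9Y (Matrix (Fin N) (Fin N) ℂ) (specialUnitaryUnits (Fin N)) x).Reg335 c α₀ U → P₇ x U) :
    ∀ x : MemberY d ℓ hd hL b₀ b₁ Mstar, M₁ ≤ (geo9Y x).M → ∀ α₀ : ℝ, 0 < α₀ → c * (geo9Y x).M * α₀ ≤ a₁ →
      ∀ U : (bg9Y (Matrix (Fin N) (Fin N) ℂ) (specialUnitaryUnits (Fin N)) x).Cfg, (bg9Y (Matrix (Fin N) (Fin N) ℂ) (specialUnitaryUnits (Fin N)) x).Reg335 c α₀ U →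
        P₁ x U ∧ P₂ x U ∧ (P₃ x U ∧ P₄ x U) ∧ (P₅ x U ∧ P₆ x U) ∧ (P₇ x U ∧ P₈ x U) := fun x hM α₀ hα ha U hU => by
  obtain ⟨h₁, h₂, h₃₄, h₅₆, h₈⟩ := h36H x hM α₀ hα ha U hU
  exact ⟨h₁, h₂, h₃₄, h₅₆, hm x hM α₀ hα ha U hU, h₈⟩

/-- ★ **THE OVERLAP COUNT `hcntM` OF `S_□ := SblkY`** from this seat's `sum_indicator_SblkY_le` under a displayed member floor `walkCntM₀Y ≤ M_x` and `walkCntY ≤ pM.NM`.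
[cite: Balaban1984PropagatorsII, Lemma 2.1 (2.61) p.234, p.235 («the cubes □̃ overlap finitely often»); Balaban1985BackgroundPropagators, p.408, bookkeeping] -/
theorem hcntM_of_walkCnt {d ℓ : ℕ} {hd : 1 ≤ d + 1} {hL : Odd (ℓ + 1) ∧ 1 < ℓ + 1} {b₀ b₁ : ℝ} {Mstar : ℕ}
    [∀ x : MemberY d ℓ hd hL b₀ b₁ Mstar, Fintype (geo9Y x).Site] [∀ x : MemberY d ℓ hd hL b₀ b₁ Mstar, DecidableEq (geo9Y x).Site]
    (bI : ∀ x : MemberY d ℓ hd hL b₀ b₁ Mstar, FBondY x.toKIdx → IBondY x.toKIdx)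
    (hβ1 : ∀ (x : MemberY d ℓ hd hL b₀ b₁ Mstar) (f : FBondY x.toKIdx), (geomT x.D).dist (β x.hN x.D x.hk (bI x f)) (blkV1 x.hN x.D f) ≤ 1)
    -- the certificate's site family `SM` (typed over `(geo9Y x).Site`, so that its own `DecidableEq` binder decides the indicator) pinned to `SblkY`
    (SM : ∀ x : MemberY d ℓ hd hL b₀ b₁ Mstar, ↥(cubes x.toKIdx.D.toDomains) → Finset (geo9Y x).Site)
    (hSM : ∀ x : MemberY d ℓ hd hL b₀ b₁ Mstar, SM x = SblkY x (bI x))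
    (hMw : ∀ x : MemberY d ℓ hd hL b₀ b₁ Mstar, walkCntM₀Y d ℓ hd hL b₀ b₁ Mstar ≤ (geo9Y x).M) {NM : ℝ} (hNM : walkCntY d ℓ hd hL b₀ b₁ Mstar ≤ NM) :
    ∀ (x : MemberY d ℓ hd hL b₀ b₁ Mstar) (a : (geo9Y x).Site), (∑ c, if a ∈ SM x c then (1 : ℝ) else 0) ≤ NM := fun x a => by
  -- the indicator is decided here by the certificate's own `DecidableEq (geo9Y x).Site` (the sum does not depend on the instance)
  have h := (sum_indicator_SblkY_le (x := x) (bI x) (hβ1 x) (hMw x) a).trans hNM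
  rw [hSM x]
  convert h using 3 <;> rfl

end Summit.QuantumFields.YangMills.BalabanUVNodes.N06MixedLegAtPinsPhys

end
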